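import Mathlib
import HarnessLib
import Literature.MathematicalPhysics.StatisticalMechanics.StrongNormExpSecond
import Literature.MathematicalPhysics.StatisticalMechanics.PolymerProductABKM
import Literature.MathematicalPhysics.StatisticalMechanics.StepOperatorBABKM
import Literature.MathematicalPhysics.StatisticalMechanics.FluctuationSmooth
import Literature.MathematicalPhysics.StatisticalMechanics.FluctuationOfHamiltonian

/-!
# The fluctuation defect `R_{k+1}e^{−H(B)} − e^{−(A_kH)(B)}` is of second order ([ABKM19] Thm 6.8)

In the renormalisation map `S_k(H,K) = K_{k+1}` ([ABKM19] (6.34)) the terms of first order in `H`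
at `K = 0` cancel EXACTLY: for a `k`-block `B` with `π(B) = U` the contributions
`R_{k+1}(e^{−H(B)} − 1)` (from `X = B`, `X₁ = ∅`) and `1 − e^{−H̃(B)}` (from `X₁ = B`) combine to the
defect `D_B(H) = R_{k+1}e^{−H(B)} − e^{−(A_kH)(B)}`, since `R_{k+1}H(B) = (A_kH)(B)` (`fluct_eval`) and
`H̃ = A_kH + B_kK` (`nextH_eq`).  This file proves that the defect is `O(‖H‖²_{k,0})` in the norm
`|·|_{k,B}` with the weight `w_{k:k+1}^B`:
`D_B(H) = R_{k+1}[e^{−H(B)} − 1 + H(B)] − [e^{−A_kH(B)} − 1 + A_kH(B)]`, each bracket being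
`≤ 256e^{1/4}‖·‖²` in the strong norm (`StrongNormExpSecond`), `W_k^B ≤ w_k^B ≤ w_{k:k+1}^B`, the
integration property ((w7), constant `A_𝒫`) and `‖A_kH‖_{k,0} ≤ 2‖H‖_{k,0}`.  This is the analytic
content of `D_H S_k(0,0) = 0` in [ABKM19] Theorem 6.8.

* `hamNorm_stepOpA_le`, `hamNorm_stepOpA_abkm_le` — `‖A_kH‖_{k,0} ≤ 2‖H‖_{k,0}` (`L^{dk}|γ_q| ≤ h²`);
* `posSemidef_circulant_abkm` — `circulant 𝒞_{k+1} ⪰ 0` for the tower's kernels;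
* `strongWeight_le_weight_abkm` — `W_k^B ≤ w_k^X` for `B ⊆ X` ((w5) with `w_k^∅ = 1`, (w1));
* `fluctDefect 𝒞 H B` — `D_B(H)`; `fluctDefect_eq` — the second-order rewriting;
* **`tayNormLE_fluctDefect_abkm`** — `|D_B(H)|_{k,B} ≤ 256e^{1/4}(A_𝒫 + 4)‖H‖²_{k,0} · w_{k:k+1}^B` for
  `‖H‖_{k,0} ≤ 1/16`.

Everything is proved; no named fact.

## References
* S. Adams, S. Buchholz, R. Kotecký, S. Müller, arXiv:1910.13564, Theorem 6.8 ((6.56), (6.61)–(6.64)),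
  Lemma 9.3, Lemma 8.4 [AdamsBuchholzKoteckyMuller2019].
-/

noncomputable section

namespace Literature.MathematicalPhysics.StatisticalMechanics.GradientRG

open scoped BigOperators
open Finset MeasureTheory
open Literature.MathematicalPhysics.QuantumFieldTheory
open Literature.MathematicalPhysics.StatisticalMechanics.TorusPolymer
  (IsPolymer Separated blockOf thicken isPolymer_blockOf card_blockOf subset_thicken blocks_blockOf
    card_blocks_eq_numBlocks numBlocks isPolymer_empty)
open Literature.MathematicalPhysics.StatisticalMechanics.GradientFRD (fourierCoeff cExt posSemidef_mulMat)
open Literature.Barriers.CriticalPhenomena.LongRangePhi4.Polymer (IsConn)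

variable {𝕜 : Type*} {d M : ℕ} [NeZero M]

/-! ## `‖A_k H‖_{k,0} ≤ 2‖H‖_{k,0}` -/

section StepOpA

variable [NormedField 𝕜] [NormedAlgebra ℝ 𝕜]

omit [NeZero M] in
/-- **`‖A H‖ ≤ 2‖H‖`** in the coefficient norm `hamNorm 𝔥 R n` (`𝔥, R ≥ 0`) when the shift is small
relative to the quadratic weights, `|γ_q| ≤ (𝔥/R)²` for all `q`: the constant coefficient of `A H` is
`a_∅ + Σ_q γ_q a_q`. [cite: AdamsBuchholzKoteckyMuller2019, Theorem 6.8 (6.56)] -/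
theorem hamNorm_stepOpA_le {𝔥 R : ℝ} (h𝔥 : 0 ≤ 𝔥) (hR : 0 ≤ R) (n : ℕ) {γ : quadIndex d → ℝ}
    (hγ : ∀ q, |γ q| ≤ (𝔥 / R) ^ 2) (H : RelevantHamiltonian 𝕜 d) :
    hamNorm 𝔥 R n (stepOpA γ H) ≤ 2 * hamNorm 𝔥 R n H := by
  unfold hamNorm
  simp only [stepOpA_const, stepOpA_lin, stepOpA_quad]
  have hn : (0 : ℝ) ≤ n := Nat.cast_nonneg _
  set c₀ : ℝ := ‖H (Sum.inl ())‖ with hc₀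
  set Sl : ℝ := ∑ α : linIndex d, 𝔥 * (R ^ (∑ i, (α : Fin d → ℕ) i))⁻¹ * ‖H (Sum.inr (Sum.inl α))‖
    with hSl
  set Sq : ℝ := ∑ q : quadIndex d, (𝔥 / R) ^ 2 * ‖H (Sum.inr (Sum.inr q))‖ with hSq
  have hshift : ‖H (Sum.inl ()) + ∑ q : quadIndex d, (γ q : ℝ) • H (Sum.inr (Sum.inr q))‖ ≤ c₀ + Sq := by
    refine (norm_add_le _ _).trans (add_le_add le_rfl ?_)
    refine (norm_sum_le _ _).trans (Finset.sum_le_sum fun q _ => ?_)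
    rw [norm_smul, Real.norm_eq_abs]
    exact mul_le_mul_of_nonneg_right (hγ q) (norm_nonneg _)
  have hc₀0 : 0 ≤ c₀ := norm_nonneg _
  have hSl0 : 0 ≤ Sl := Finset.sum_nonneg fun α _ =>
    mul_nonneg (mul_nonneg h𝔥 (inv_nonneg.2 (pow_nonneg hR _))) (norm_nonneg _)
  have hSq0 : 0 ≤ Sq := Finset.sum_nonneg fun q _ => mul_nonneg (sq_nonneg _) (norm_nonneg _)
  calc (n : ℝ) * (‖H (Sum.inl ()) + ∑ q : quadIndex d, (γ q : ℝ) • H (Sum.inr (Sum.inr q))‖ + Sl + Sq)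
      ≤ n * ((c₀ + Sq) + Sl + Sq) := by gcongr
    _ ≤ 2 * (n * (c₀ + Sl + Sq)) := by nlinarith

omit [NeZero M] in
/-- **`‖A_kH‖_{k,0} ≤ 2‖H‖_{k,0}` at the torus scales**: coefficient norm at `(𝔥_k, L^k, L^{dk})` and a
shift with `L^{dk}|γ_q| ≤ h²` ((10.39)), `d ≥ 2`, `L ≥ 1`, `h > 0`.
[cite: AdamsBuchholzKoteckyMuller2019, Theorem 6.8 (6.56)] -/
theorem hamNorm_stepOpA_abkm_le {L : ℕ} {h : ℝ} (hd : 2 ≤ d) (hL : 1 ≤ L) (hh : 0 < h) (k : ℕ)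
    {γ : quadIndex d → ℝ} (hγ : ∀ q, ((L ^ (d * k) : ℕ) : ℝ) * |γ q| ≤ h ^ 2)
    (H : RelevantHamiltonian 𝕜 d) :
    hamNorm (fieldWt h L d k) ((L : ℝ) ^ k) (L ^ (d * k)) (stepOpA γ H) ≤
      2 * hamNorm (fieldWt h L d k) ((L : ℝ) ^ k) (L ^ (d * k)) H := by
  have hL0 : (0 : ℝ) < L := by exact_mod_cast (show 0 < L by omega)
  refine hamNorm_stepOpA_le (fieldWt_pos hh hL0 d k).le (by positivity) _ (fun q => ?_) H
  -- `(𝔥_k / L^k)² = h_k² / L^{dk} ≥ h² / L^{dk} ≥ |γ_q|`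
  have hsq := fieldWt_sq_mul (h := h) hL0 d k
  rw [hScale_sq] at hsq
  have hLp : (L : ℝ) ^ (d * k) = ((L : ℝ) ^ k) ^ (d - 2) * ((L : ℝ) ^ k) ^ 2 := by
    rw [← pow_mul, ← pow_mul, ← pow_add]; congr 1
    have : d = (d - 2) + 2 := by omega
    conv_lhs => rw [this]
    ring
  have hLdk : (0 : ℝ) < (L : ℝ) ^ (d * k) := by positivity
  have key : (fieldWt h L d k / (L : ℝ) ^ k) ^ 2 = 4 ^ k * h ^ 2 / (L : ℝ) ^ (d * k) := by
    rw [div_pow, hLp, ← hsq]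
    have hne : ((L : ℝ) ^ k) ^ 2 ≠ 0 := by positivity
    have hne' : ((L : ℝ) ^ k) ^ (d - 2) ≠ 0 := by positivity
    field_simp
  rw [key, le_div_iff₀ hLdk]
  have h4 : (1 : ℝ) ≤ 4 ^ k := one_le_pow₀ (by norm_num)
  have hγ' : |γ q| * (L : ℝ) ^ (d * k) ≤ h ^ 2 := by
    have := hγ q; push_cast at this; linarith [this]
  nlinarith [sq_nonneg h, abs_nonneg (γ q)]

end StepOpA

/-! ## Kernel and weight facts of the tower -/

/-- `circulant 𝒞_{k+1}` is positive semidefinite for the tower's kernels (non-negative multipliers).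
[cite: AdamsBuchholzKoteckyMuller2019, Theorem 7.1 (i)] -/
theorem posSemidef_circulant_abkm {L N Mord R n : ℕ} {θbar lam μ δ₁ δ₀ A𝒫 : ℝ}
    {𝒞 : ℕ → (Fin d → ZMod M) → ℝ}
    (hB : AbkmWeightBounds L N Mord R n θbar lam μ δ₁ δ₀ A𝒫 𝒞
      (abkmWeightData L N Mord R θbar (schedDelta δ₀ δ₁ N) 𝒞))
    {k : ℕ} (hk : k + 1 ≤ N + 1) : (Matrix.circulant (𝒞 (k + 1))).PosSemidef := by
  have heven_all : ∀ j ∈ Finset.Icc 1 (N + 1), ∀ x, 𝒞 j (-x) = 𝒞 j x :=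
    fun j hj => (hB.zero_sum_even j hj).2
  have heven : ∀ x, 𝒞 (k + 1) (-x) = 𝒞 (k + 1) x := heven_all (k + 1) (Finset.mem_Icc.2 ⟨by omega, hk⟩)
  rw [circulant_eq_mulMat_cExt hk heven (N := N)]
  exact posSemidef_mulMat fun κ => hB.multipliers_nonneg (k + 1) κ

/-- **`W_k^B ≤ w_k^X` for `B ⊆ X`** (`X` a `k`-polymer): the strong weight of [ABKM19] is dominated by
the weak one ((w5) with `Y = ∅`, `w_k^∅ = 1`, and monotonicity (w1)).
[cite: AdamsBuchholzKoteckyMuller2019, Theorem 7.1 (w5)] -/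
theorem strongWeight_le_weight_abkm {L N Mord R n : ℕ} {θbar lam μ δ₁ δ₀ A𝒫 h : ℝ}
    {𝒞 : ℕ → (Fin d → ZMod M) → ℝ}
    (hB : AbkmWeightBounds L N Mord R n θbar lam μ δ₁ δ₀ A𝒫 𝒞
      (abkmWeightData L N Mord R θbar (schedDelta δ₀ δ₁ N) 𝒞))
    (hδ₀ : 0 < δ₀) (hδ₁ : 0 < δ₁) (hh : 0 < h) (hh0 : hZeroSq d R δ₀ δ₁ ≤ h ^ 2) (k : ℕ)
    {B X : Finset (Fin d → ZMod M)} (hBX : B ⊆ X) (φ : (Fin d → ZMod M) → ℝ) :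
    expWeight (strongCoef h N k • derivForm (L : ℝ) k (diffIndex d Mord)
        (boxDensity (boxRad R L k) (boxWt (L : ℝ) d k) B)) φ ≤
      (abkmWeightData L N Mord R θbar (schedDelta δ₀ δ₁ N) 𝒞).weight k X φ := by
  set W := abkmWeightData L N Mord R θbar (schedDelta δ₀ δ₁ N) 𝒞 with hW
  have hGs : W.StrongDominated (fun j Y => strongCoef h N j • derivForm (L : ℝ) j (diffIndex d Mord)
      (boxDensity (boxRad R L j) (boxWt (L : ℝ) d j) Y)) fun _ X Y => Disjoint X Y :=
    hB.strong (diffIndex d Mord) (fun α hα => hα) (strongCoef h N) (strongCoef_le hδ₀ hδ₁ hh hh0)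
  have hwU : ∀ X' Y', IsPolymer (L ^ k) X' → IsPolymer (L ^ k) Y' → Separated (L ^ k + 1) X' Y' →
      ∀ φ, W.weight k (X' ∪ Y') φ = W.weight k X' φ * W.weight k Y' φ := fun X' Y' _ _ hsep φ =>
    WeightData.weight_union hB.dominated hB.isLocal hB.additive (k := k) hsep φ
  have hw0 : W.weight k ∅ φ = 1 := weight_empty_of_union hwU (fun φ => W.weight_pos k ∅ φ) φ
  have h1 := WeightData.weight_mul_strongWeight_le hB.dominated hB.monotone hGs (k := k) (X := ∅) (Y := B)
    (Finset.disjoint_empty_left B) φ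
  rw [hw0, one_mul, Finset.empty_union] at h1
  exact h1.trans (WeightData.weight_mono hB.dominated hB.monotone k hBX φ)

/-! ## The defect and its second-order bound -/

/-- **The fluctuation defect `D_B(H)(φ) = (R_{k+1}e^{−H(B)})(φ) − e^{−(A_kH)(B, φ)}`** of a block `B`
(`R_{k+1} = fluct 𝒞`, `A_k = stepOpA (gradCov 𝒞)`).
[cite: AdamsBuchholzKoteckyMuller2019, Theorem 6.8 ((6.61)–(6.64))] -/
def fluctDefect (𝒞 : (Fin d → ZMod M) → ℝ) (H : RelevantHamiltonian ℂ d) (B : Finset (Fin d → ZMod M))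
    (φ : (Fin d → ZMod M) → ℝ) : ℂ :=
  fluct 𝒞 (expNegH H B) φ - expNegH (stepOpA (gradCov 𝒞) H) B φ

/-- **The second-order rewriting of the defect**: if `e^{−H(B,φ+·)}` and `e^{−H(B,φ+·)} − 1 + H(B,φ+·)`
are `μ_{k+1}`-integrable for every `φ` and `circulant 𝒞 ⪰ 0`, then
`D_B(H) = R_{k+1}[e^{−H(B)} − 1 + H(B)] − [e^{−A_kH(B)} − 1 + A_kH(B)]` (by `R_{k+1}1 = 1`,
`R_{k+1}H(B) = A_kH(B)`). [cite: AdamsBuchholzKoteckyMuller2019, Theorem 6.8 ((6.61)–(6.64))] -/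
theorem fluctDefect_eq {𝒞 : (Fin d → ZMod M) → ℝ} (hC : (Matrix.circulant 𝒞).PosSemidef)
    (H : RelevantHamiltonian ℂ d) (B : Finset (Fin d → ZMod M))
    (hI : ∀ φ, Integrable (fun ξ => expNegH H B (φ + ξ)) (stepMeasure 𝒞))
    (hI2 : ∀ φ, Integrable (fun ξ => expNegH H B (φ + ξ) - 1 + eval H B (φ + ξ)) (stepMeasure 𝒞))
    (φ : (Fin d → ZMod M) → ℝ) :
    fluctDefect 𝒞 H B φ =
      fluct 𝒞 (fun ψ => expNegH H B ψ - 1 + eval H B ψ) φ -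
        (expNegH (stepOpA (gradCov 𝒞) H) B φ - 1 + eval (stepOpA (gradCov 𝒞) H) B φ) := by
  haveI := isProbabilityMeasure_stepMeasure 𝒞
  have hIe : Integrable (fun ξ => eval H B (φ + ξ)) (stepMeasure 𝒞) := by
    have h := ((hI2 φ).sub (hI φ)).add (integrable_const (1 : ℂ))
    refine h.congr (ae_of_all _ fun ξ => ?_)
    simp only [Pi.add_apply, Pi.sub_apply]
    ring
  have hA : fluct 𝒞 (eval H B) φ = eval (stepOpA (gradCov 𝒞) H) B φ := fluct_eval hC H B φ
  unfold fluctDefect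
  unfold fluct at hA ⊢
  have hsplit : ∫ ξ, (expNegH H B (φ + ξ) - 1 + eval H B (φ + ξ)) ∂(stepMeasure 𝒞) =
      (∫ ξ, expNegH H B (φ + ξ) ∂(stepMeasure 𝒞)) - 1 + ∫ ξ, eval H B (φ + ξ) ∂(stepMeasure 𝒞) := by
    have h1 : Integrable (fun ξ => expNegH H B (φ + ξ) - 1) (stepMeasure 𝒞) := (hI φ).sub (integrable_const 1)
    rw [integral_add h1 hIe, integral_sub (hI φ) (integrable_const _)]
    simp
  rw [hsplit, hA]
  ring

/-- **The fluctuation defect is of second order** for the torus data: on the block `B = B_x` at scale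
`k ≤ N` (`d ≥ 2`, `L` odd, `M = L^N`, tower with `AbkmWeightBounds`, `θ̄, λ, δ₀, δ₁ > 0`, `h² ≥ h₀²`,
`⌊d/2⌋+1 ≤ min(p, M_ord)`, shift `L^{dk}|γ_q| ≤ h²` for `γ = gradCov 𝒞_{k+1}`) and `‖H‖_{k,0} ≤ 1/16`
(at `(𝔥_k, L^k, L^{dk})`):
`|D_B(H)|_{k,B,T_φ} ≤ 256e^{1/4}(A_𝒫 + 4)‖H‖²_{k,0} · w_{k:k+1}^B(φ)`.
[cite: AdamsBuchholzKoteckyMuller2019, Theorem 6.8 ((6.56), (6.61)–(6.64))] -/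
theorem tayNormLE_fluctDefect_abkm {L N Mord R n p r₀ : ℕ} {θbar lam μ δ₁ δ₀ A𝒫 h A : ℝ}
    {𝒞 : ℕ → (Fin d → ZMod M) → ℝ} (hd : 2 ≤ d) (hθbar : 0 < θbar) (hlam : 0 < lam)
    (hB : AbkmWeightBounds L N Mord R n θbar lam μ δ₁ δ₀ A𝒫 𝒞
      (abkmWeightData L N Mord R θbar (schedDelta δ₀ δ₁ N) 𝒞))
    (hLodd : Odd L) (hM : M = L ^ N) {k : ℕ} (hk : k ≤ N) (hδ₀ : 0 < δ₀) (hδ₁ : 0 < δ₁) (hh : 0 < h)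
    (hh0 : hZeroSq d R δ₀ δ₁ ≤ h ^ 2) (hMord : d / 2 + 1 ≤ Mord) (hp : d / 2 + 1 ≤ p)
    (hγ : ∀ q, ((L ^ (d * k) : ℕ) : ℝ) * |gradCov (𝒞 (k + 1)) q| ≤ h ^ 2)
    (x : Fin d → ZMod M) {H : RelevantHamiltonian ℂ d}
    (hH : hamNorm (fieldWt h (L : ℝ) d k) ((L : ℝ) ^ k) (L ^ (d * k)) H ≤ 1 / 16) :
    TayNormLE ((abkmNormParams L N Mord R p r₀ h θbar A (schedDelta δ₀ δ₁ N) 𝒞).gauge k (blockOf (L ^ k) x))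
      r₀ ((abkmWeightData L N Mord R θbar (schedDelta δ₀ δ₁ N) 𝒞).midWeight k (blockOf (L ^ k) x))
      (fluctDefect (𝒞 (k + 1)) H (blockOf (L ^ k) x))
      (256 * Real.exp (1 / 4) * (A𝒫 + 4) *
        hamNorm (fieldWt h (L : ℝ) d k) ((L : ℝ) ^ k) (L ^ (d * k)) H ^ 2) := by
  set P := abkmNormParams L N Mord R p r₀ h θbar A (schedDelta δ₀ δ₁ N) 𝒞 with hP
  set W := abkmWeightData L N Mord R θbar (schedDelta δ₀ δ₁ N) 𝒞 with hW
  set B := blockOf (L ^ k) x with hBdef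
  set nH := hamNorm (fieldWt h (L : ℝ) d k) ((L : ℝ) ^ k) (L ^ (d * k)) H with hnH
  set AH := stepOpA (gradCov (𝒞 (k + 1))) H with hAH
  have hL0 : (0 : ℝ) < L := by exact_mod_cast hLodd.pos
  have hL1 : 1 ≤ L := hLodd.pos
  have hk' : k + 1 ≤ N + 1 := by omega
  obtain ⟨t, ht⟩ : ∃ t, N = k + t := ⟨N - k, by omega⟩
  have hMt : M = L ^ k * L ^ t := by rw [← pow_add, ← ht]; exact hM
  have hcard : B.card = L ^ (d * k) := by
    rw [hBdef, card_blockOf hMt hLodd.pow hLodd.pow x, ← pow_mul, mul_comm]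
  have h𝔥 : 0 < fieldWt h (L : ℝ) d k := fieldWt_pos hh hL0 d k
  have hRk : (0 : ℝ) < (L : ℝ) ^ k := by positivity
  have hnH0 : 0 ≤ nH := hamNorm_nonneg h𝔥.le hRk.le _ _
  have hHB : hamNorm (fieldWt h (L : ℝ) d k) ((L : ℝ) ^ k) B.card H ≤ 1 / 8 := by
    rw [hcard]; linarith
  have hHB' : hamNorm (fieldWt h (L : ℝ) d k) ((L : ℝ) ^ k) B.card H ≤ 1 / 16 := by rw [hcard]; exact hH
  -- `‖A_k H‖ ≤ 2‖H‖ ≤ ⅛`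
  have hAH2 : hamNorm (fieldWt h (L : ℝ) d k) ((L : ℝ) ^ k) (L ^ (d * k)) AH ≤ 2 * nH :=
    hamNorm_stepOpA_abkm_le hd hL1 hh k hγ H
  have hAHB : hamNorm (fieldWt h (L : ℝ) d k) ((L : ℝ) ^ k) B.card AH ≤ 1 / 8 := by
    rw [hcard]; linarith
  have hBS : B ⊆ thicken (P.rad k) B := subset_thicken _ _
  have hgauge : P.gauge k B = fieldGauge (fieldWt h (L : ℝ) d k) ((L : ℝ) ^ k) p (thicken (P.rad k) B) := rfl
  -- the strong weight of `B` is below `w_k^B ≤ w_{k:k+1}^B`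
  have hSW : ∀ φ, expWeight (strongCoef h N k • derivForm (L : ℝ) k (diffIndex d Mord)
      (boxDensity (boxRad R L k) (boxWt (L : ℝ) d k) B)) φ ≤ W.weight k B φ :=
    fun φ => strongWeight_le_weight_abkm hB hδ₀ hδ₁ hh hh0 k (subset_refl B) φ
  have hwm : ∀ φ, W.weight k B φ ≤ W.midWeight k B φ := fun φ =>
    WeightData.weight_le_midWeight hB.dominated k B φ
  -- the two second-order brackets
  set F₁ : ((Fin d → ZMod M) → ℝ) → ℂ := fun ψ => expNegH H B ψ - 1 + eval H B ψ with hF₁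
  set F₂ : ((Fin d → ZMod M) → ℝ) → ℂ := fun ψ => expNegH AH B ψ - 1 + eval AH B ψ with hF₂
  have hF₁s := tayNormLE_expNegH_sub_one_add_strong_abkm (R := R) (Mord := Mord) hd hLodd hM hk hh hMord hp
    hBS r₀ hHB
  have hF₂s := tayNormLE_expNegH_sub_one_add_strong_abkm (R := R) (Mord := Mord) hd hLodd hM hk hh hMord hp
    hBS r₀ hAHB
  rw [← hgauge] at hF₁s hF₂s
  have hc₁ : 0 ≤ 256 * Real.exp (1 / 4) * hamNorm (fieldWt h (L : ℝ) d k) ((L : ℝ) ^ k) B.card H ^ 2 := by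
    positivity
  have hc₂ : 0 ≤ 256 * Real.exp (1 / 4) * hamNorm (fieldWt h (L : ℝ) d k) ((L : ℝ) ^ k) B.card AH ^ 2 := by
    positivity
  have hF₁w : TayNormLE (P.gauge k B) r₀ (W.weight k B) F₁
      (256 * Real.exp (1 / 4) * hamNorm (fieldWt h (L : ℝ) d k) ((L : ℝ) ^ k) B.card H ^ 2) :=
    hF₁s.mono_weight hc₁ hSW
  have hF₂w : TayNormLE (P.gauge k B) r₀ (W.midWeight k B) F₂
      (256 * Real.exp (1 / 4) * hamNorm (fieldWt h (L : ℝ) d k) ((L : ℝ) ^ k) B.card AH ^ 2) :=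
    (hF₂s.mono_weight hc₂ hSW).mono_weight hc₂ hwm
  -- differentiability and locality
  have hF₁d : ContDiff ℝ r₀ F₁ :=
    (((contDiff_eval H B (n := r₀)).neg.cexp).sub contDiff_const).add (contDiff_eval H B)
  have hF₂d : ContDiff ℝ r₀ F₂ :=
    (((contDiff_eval AH B (n := r₀)).neg.cexp).sub contDiff_const).add (contDiff_eval AH B)
  have hev : IsGaugeLocal (P.gauge k B) (fun φ : (Fin d → ZMod M) → ℝ => eval H B φ) := by
    rw [hgauge]; exact isGaugeLocal_eval h𝔥.ne' hRk.ne' hp hBS H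
  have hevA : IsGaugeLocal (P.gauge k B) (fun φ : (Fin d → ZMod M) → ℝ => eval AH B φ) := by
    rw [hgauge]; exact isGaugeLocal_eval h𝔥.ne' hRk.ne' hp hBS AH
  have hF₁loc : IsGaugeLocal (P.gauge k B) F₁ := fun φ ψ hT => by
    simp only [hF₁, expNegH, hev φ ψ hT]
  have hexp_loc : IsGaugeLocal (P.gauge k B) (expNegH H B) := fun φ ψ hT => by
    simp only [expNegH, hev φ ψ hT]
  have hexp_d : ContDiff ℝ r₀ (expNegH H B) := by
    show ContDiff ℝ r₀ (fun φ : (Fin d → ZMod M) → ℝ => Complex.exp (-(eval H B φ)))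
    exact (contDiff_eval H B (n := r₀)).neg.cexp
  -- the block is a connected `k`-polymer with one block
  have hMo : Odd M := by rw [hM]; exact hLodd.pow
  have hBpoly : IsPolymer (L ^ k) B := isPolymer_blockOf _ x
  have hBconn : IsConn B := TorusPolymer.isConn_blockOf hMo hLodd.pow x
  have hnB : numBlocks (L ^ k) B = 1 := by
    rw [← card_blocks_eq_numBlocks, hBdef, blocks_blockOf, card_singleton]
  -- `R_{k+1}F₁`
  have hRF₁ : TayNormLE (P.gauge k B) r₀ (W.midWeight k B) (fluct (𝒞 (k + 1)) F₁)
      (256 * Real.exp (1 / 4) * hamNorm (fieldWt h (L : ℝ) d k) ((L : ℝ) ^ k) B.card H ^ 2 * A𝒫) := by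
    have h := integrationProperty_abkm hθbar hlam hB hk' p r₀ h A B hBpoly hBconn F₁ _ hc₁ hF₁d hF₁loc hF₁w
    have e : numBlocks (P.L ^ k) B = 1 := hnB
    rw [e, pow_one] at h
    exact h
  have hRF₁d : ContDiff ℝ r₀ (fluct (𝒞 (k + 1)) F₁) :=
    contDiff_fluct_abkm hθbar hlam hB hk' B (P.gauge k B) hc₁ hF₁d hF₁loc hF₁w
  -- the identity `D_B(H) = R F₁ − F₂`
  have hC := posSemidef_circulant_abkm hB hk'
  have hdom := weightSectionDominated_abkm hθbar hlam hB hk' B (P.gauge k B)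
  have hexp_s := tayNormLE_expNegH_strong_abkm (R := R) (Mord := Mord) hd hLodd hM hk hh hMord hp hBS r₀ hHB
  rw [← hgauge] at hexp_s
  have hexp_w : TayNormLE (P.gauge k B) r₀ (W.weight k B) (expNegH H B) (Real.exp (1 / 4)) :=
    hexp_s.mono_weight (Real.exp_pos _).le hSW
  have hI : ∀ φ, Integrable (fun ξ => expNegH H B (φ + ξ)) (stepMeasure (𝒞 (k + 1))) := fun φ =>
    integrable_comp_add_of_tayNormLE hexp_w (Real.exp_pos _).le hexp_d hexp_loc hdom φ
  have hI2 : ∀ φ, Integrable (fun ξ => F₁ (φ + ξ)) (stepMeasure (𝒞 (k + 1))) := fun φ =>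
    integrable_comp_add_of_tayNormLE hF₁w hc₁ hF₁d hF₁loc hdom φ
  have heq : fluctDefect (𝒞 (k + 1)) H B = fluct (𝒞 (k + 1)) F₁ + (-1 : ℝ) • F₂ := by
    funext φ
    rw [fluctDefect_eq hC H B hI hI2 φ, Pi.add_apply, Pi.smul_apply, neg_one_smul, ← sub_eq_add_neg]
  rw [heq]
  -- combine
  have hsum := hRF₁.add (hF₂w.smul hF₂d (-1)) hRF₁d (hF₂d.const_smul (-1 : ℝ))
  refine hsum.mono ?_ (fun φ => (W.midWeight_pos k B φ).le)
  rw [hcard, ← hnH, abs_neg, abs_one, one_mul]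
  have hAq : hamNorm (fieldWt h (L : ℝ) d k) ((L : ℝ) ^ k) (L ^ (d * k)) AH ^ 2 ≤ (2 * nH) ^ 2 :=
    pow_le_pow_left₀ (hamNorm_nonneg h𝔥.le hRk.le _ _) hAH2 2
  have he : 0 ≤ 256 * Real.exp (1 / 4) := by positivity
  nlinarith [mul_le_mul_of_nonneg_left hAq he, sq_nonneg nH]

end Literature.MathematicalPhysics.StatisticalMechanics.GradientRG

end
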